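import Summits.QuantumFields.YangMills.Theorems.F4SubCurvatureDoorGlobalReductionCertificate
import Mathlib
import HarnessLib

/-!
# NEGATIVE TARGET (typed, defs only) «BIG-O BUDGET SHARPNESS» for crux ⟨stmt-QuantumFields-23035⟩ `ShortRootRigidity`
# — owner duty (c) of seat ym-idea-3 g21; director-ym SEAT WORD #2 (2026-08-29T10:28:45Z) item (c); critic idea-crit-4 g8 endorsement 10:28:28Z (3)

WHAT THIS FILE IS.  A by-name TARGET for a free hand of the cell (size M): the statement
`NotShortRootRigidityBigO : Prop` («C3 / ShortRootRigidity with the little-o sub-curvature budget `‖x‖⁸K → 0` replaced by the big-O budget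
`‖x‖⁸|K| ≤ C` is FALSE»), the explicit WITNESS `bigOWitness`, and the proof route.  Land it as
`Summits/QuantumFields/YangMills/Theorems/ShortRootRigidity/Negative/BigOBudgetSharpness.lean` with the Props below restated
character-identically and `theorem not_shortRootRigidityBigO : NotShortRootRigidityBigO` (`--supports stmt-QuantumFields-23035 --as helper`;
it is negative knowledge for every line on ⟨23035⟩/⟨23125⟩: ANY proof of `ShortRootRigidity` must use the little-o at exponent 8, i.e. it is a
`ShortRootRigidity_false_without_littleO`-type lemma).  It SUPPORTS the lines (angular_type: the count, not positivity, carries S4; sextic_channel /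
shell_separation: the sextic channel / the first anisotropic shell layer sits exactly at the budget threshold).  Nothing here is a stub of a line;
no registry change.  HONEST LABEL: a sharpness statement about the HYPOTHESES of an open crux; nothing of ⟨23035⟩, R2d or YM is proved.

THE WITNESS.  `h₆(x) := Σᵢ xᵢ⁶ − 5 Σ_{i≠j} xᵢ⁴xⱼ² + 30 Σ_{i<j<k} xᵢ²xⱼ²xₖ²` is the (unique up to scale and multiples of ‖x‖⁶) W(F₄)-invariant
HARMONIC sextic; the LATTICE FORM used below is `3·h₆(x) = 15‖x‖⁶ − Σ_{v ∈ D₄, ‖v‖² = 2} ⟪v, x⟫⁶` (the 24 vectors ±eᵢ±eⱼ; check: Σ_v⟪v,x⟫⁶ =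
12Σxᵢ⁶ + 60Σ_{i≠j}xᵢ⁴xⱼ², ‖x‖⁶ = Σxᵢ⁶ + 3Σ_{i≠j}xᵢ⁴xⱼ² + 6Σ_{i<j<k}xᵢ²xⱼ²xₖ²), which makes invariance under EVERY isometry preserving D₄
immediate (such an `R` is injective, norm-preserving and maps the finite set of norm-√2 lattice vectors into itself, hence permutes it).
`K(x) := 3h₆(x)/‖x‖¹⁴` (`= 0` at `x = 0` by `0/0 = 0`).  Then:
* continuity off 0, boundedness outside the unit ball (|K| ≤ 3·max|h₆| on the sphere ≤ 3·(15 + 24·… ) crude), big-O budget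
  `‖x‖⁸|K(x)| = 3|h₆(x/‖x‖)| ≤ C` — all elementary;
* W(B₄)-invariance and D₄-isometry invariance — from the lattice form (signed permutations also permute the 24 vectors);
* NOT O(4)-invariant: `3h₆(e₀) = 3`, `3h₆((e₀+e₁)/√2) = −3` (so `K(e₀) = 3 ≠ −3 = K((e₀+e₁)/√2)`, same norm);
* harmonic: Δh₆ = 30Σx⁴ − 5(24Σ_{i<j}xᵢ²xⱼ² + 6Σx⁴) + 30·4Σ_{i<j}xᵢ²xⱼ² = 0, so by Hobson's formula `h(∂)F(‖x‖²) = 2⁶F⁽⁶⁾(‖x‖²)h(x)` for harmonic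
  sextics: `3h₆(∂)(‖x‖⁻²) = 46080 · K(x)`, i.e. K is (a positive multiple of) `h₆(∂)` applied to the massless free propagator;
* REFLECTION POSITIVITY across `x₀ = 0` (the only non-trivial clause) via the Laplace–Fourier representation, for `t ≠ 0`, `z ∈ ℝ³`:
      `K(t, z) = (1/(1280π)) ∫_{ℝ³} W(p) e^{−|t|‖p‖} cos⟪p, z⟫ ‖p‖⁻¹ dp`,   `W(p) := Σ_{j≠k} pⱼ⁴pₖ² + 2 p₁²p₂²p₃² ≥ 0`
  (`W(p)/48 = e₁e₂ − e₃` of `(p₁², p₂², p₃²)` is the null-shell symbol `h₆(‖p‖, i p)` — it vanishes exactly on the axis-null rays and equals 12, 14.2…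
  on the diagonal ones, matching idea-crit-4's numerics); then for points `xᵢ = (tᵢ, zᵢ)` with `tᵢ > 0`:
  `Σᵢⱼ cᵢcⱼ K(θxᵢ − xⱼ) = Σᵢⱼ cᵢcⱼ K(tᵢ + tⱼ, zⱼ − zᵢ) = (1/(1280π)) ∫ W(p)‖p‖⁻¹ |Σᵢ cᵢ e^{−tᵢ‖p‖} e^{i⟪p,zᵢ⟫}|² dp ≥ 0`.
  ROUTE TO THE REPRESENTATION WITHOUT SPHERICAL COORDINATES (all Mathlib): (i) subordination `e^{−u‖p‖} = ∫₀^∞ (u/(2√π)) s^{−3/2} e^{−u²/(4s)}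
  e^{−s‖p‖²} ds` and the 1-D Gaussian Fourier integrals (`fourierIntegral_gaussian`/`integral_cexp_quadratic`-type) give the POISSON KERNEL
  `∫_{ℝ³} e^{−u‖p‖} cos⟪p,z⟫ dp = 8π u/(u² + ‖z‖²)²` (the s-integral is a Γ(2)-integral); (ii) `‖p‖⁻¹e^{−t‖p‖} = ∫_t^∞ e^{−u‖p‖} du` + Fubini ⇒
  BASE IDENTITY `∫_{ℝ³} e^{−t‖p‖} cos⟪p,z⟫ ‖p‖⁻¹ dp = 4π/(t² + ‖z‖²)` (t > 0); (iii) differentiate (ii) under the integral sign in `z`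
  (`hasDerivAt_integral_of_dominated_loc_of_deriv_le`, dominants `‖p‖⁵e^{−t‖p‖}`): `−(Σ_{j≠k}∂ⱼ⁴∂ₖ² + 2∂₁²∂₂²∂₃²)(4π/(t²+‖z‖²)) = ∫ W(p)e^{−t‖p‖}cos⟪p,z⟫‖p‖⁻¹dp`,
  and the left side is the rational function `46080·4π·3h₆(t,z)/(t²+‖z‖²)⁷ /144·…` — precisely: `(Σ_{j≠k}∂ⱼ⁴∂ₖ² + 2∂₁²∂₂²∂₃²)` has symbol `−W(p)`
  and on the HARMONIC function `(t²+‖z‖²)⁻¹` (∂ₜ² = −Δ_z) it agrees with `−3h₆(∂ₜ,∇_z)·(1/48)·…`; the cleanest bookkeeping is to verify the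
  final rational identity `−(Σ_{j≠k}∂ⱼ⁴∂ₖ² + 2∂₁²∂₂²∂₃²)(1/(t²+‖z‖²)) = 960 · 3h₆(t,z)/(t²+‖z‖²)⁷` symbolically (a finite `field_simp; ring`
  computation; 960 = 46080/48) — any positive constant suffices for RP.
SIZE: M (the representation is L-ish bookkeeping but every step is in Mathlib; the symmetry clauses are finite-set permutation arguments).

WHY IT MATTERS.  `Tendsto (‖x‖⁸K) (𝓝[≠]0) (𝓝 0)` in ⟨23035⟩/C3 is SHARP IN 4D: the witness is in the big-O class, W(F₄)-symmetric, RP, and not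
radial.  (For W(B₄) alone the QUARTIC harmonic already breaks rigidity inside the little-o budget — tree `Theorems/RationalShortRootRigidity/
Negative/FalseWithoutF4Reflection.lean`; for W(F₄) the first anisotropic harmonic degree is 6 and lands exactly on exponent 8.)
-/

set_option autoImplicit false

noncomputable section

namespace Summit.QuantumFields.YangMills.Cruxes.ShortRootRigidity.Sharpness

open scoped Topology BigOperators
open Filter Set
open Literature.MathematicalPhysics.QuantumLattice (timeReflection siteToE)
open Summit.QuantumFields.YangMills.Cruxes.OSLegsAtWeakCouplingC.Sketch (IsSignedPerm)

/-- `ℝ⁴`. -/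
abbrev E4 := EuclideanSpace ℝ (Fin 4)

/-- The coordinate vector `eᵢ`. [problem-side definition] -/
def e (i : Fin 4) : E4 := EuclideanSpace.single i (1 : ℝ)

/-- The 24 minimal vectors `±eᵢ ± eⱼ` (`i < j`) of the checkerboard lattice `D₄`, listed with signs `(σ, τ) ∈ {±1}²` as a function on
`Fin 4 × Fin 4 × Bool × Bool` restricted to `i < j` inside the sum below. [problem-side definition] -/
def rootVec (i j : Fin 4) (a b : Bool) : E4 :=
  (if a then (1 : ℝ) else -1) • e i + (if b then (1 : ℝ) else -1) • e j

/-- The lattice sextic `Σ_{v ∈ D₄, ‖v‖² = 2} ⟪v, x⟫⁶` (sum over `i < j` and the four sign choices). [problem-side definition] -/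
def rootSextic (x : E4) : ℝ :=
  ∑ i : Fin 4, ∑ j : Fin 4, if i < j then
    (inner ℝ (rootVec i j true true) x) ^ 6 + (inner ℝ (rootVec i j true false) x) ^ 6 +
    (inner ℝ (rootVec i j false true) x) ^ 6 + (inner ℝ (rootVec i j false false) x) ^ 6
  else 0

/-- `3·h₆(x) = 15‖x‖⁶ − Σ_v ⟪v,x⟫⁶`, the W(F₄)-invariant harmonic sextic in lattice form
(`h₆ = Σxᵢ⁶ − 5Σ_{i≠j}xᵢ⁴xⱼ² + 30Σ_{i<j<k}xᵢ²xⱼ²xₖ²`). [problem-side definition] -/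
def h6three (x : E4) : ℝ := 15 * ‖x‖ ^ 6 - rootSextic x

/-- THE WITNESS `K(x) = 3h₆(x)/‖x‖¹⁴` (value `0` at `x = 0`). [problem-side definition] -/
def bigOWitness (x : E4) : ℝ := h6three x / ‖x‖ ^ 14

/-- C3 «GLOBAL SHORT-ROOT RIGIDITY» with the BIG-O budget `‖x‖⁸|K x| ≤ C` in place of the little-o budget — the six binders are otherwise
character-identical to the tree certificate `F4SubCurvatureDoorGlobalReduction.shortRootRigidity_iff_global` / `InClass`. [problem-side definition] -/
def ShortRootRigidityBigO : Prop :=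
  ∀ K : E4 → ℝ,
    ContinuousOn K {x | x ≠ 0} →
    (∃ C : ℝ, ∀ x, 1 ≤ ‖x‖ → |K x| ≤ C) →
    (∀ R : E4 ≃ₗᵢ[ℝ] E4, IsSignedPerm R → ∀ x, K (R x) = K x) →
    (∀ (m : ℕ) (x : Fin m → E4) (c : Fin m → ℝ), (∀ i, 0 < x i 0) →
        0 ≤ ∑ i, ∑ j, c i * c j * K (timeReflection 4 (x i) - x j)) →
    (∃ C : ℝ, ∀ x, x ≠ 0 → ‖x‖ ^ 8 * |K x| ≤ C) →
    (∀ R : E4 ≃ₗᵢ[ℝ] E4,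
        (∀ z : Fin 4 → ℤ, Even (∑ i, z i) → ∃ w : Fin 4 → ℤ, Even (∑ i, w i) ∧ R (siteToE z) = siteToE w) →
        ∀ x, K (R x) = K x) →
    ∀ (R : E4 ≃ₗᵢ[ℝ] E4) (x : E4), K (R x) = K x

/-- **NEGATIVE TARGET (by name)**: the big-O version of C3 is false. [problem-side target; land as
`theorem not_shortRootRigidityBigO : NotShortRootRigidityBigO` under `Theorems/ShortRootRigidity/Negative/`] -/
def NotShortRootRigidityBigO : Prop := ¬ ShortRootRigidityBigO

/-- The witness clauses, split out so that helpers can land one at a time (each a by-name sub-target). [problem-side targets] -/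
def WitnessContinuousOffZero : Prop := ContinuousOn bigOWitness {x | x ≠ 0}

def WitnessBoundedOutsideBall : Prop := ∃ C : ℝ, ∀ x, 1 ≤ ‖x‖ → |bigOWitness x| ≤ C

def WitnessSignedPermInvariant : Prop := ∀ R : E4 ≃ₗᵢ[ℝ] E4, IsSignedPerm R → ∀ x, bigOWitness (R x) = bigOWitness x

def WitnessReflectionPositive : Prop :=
  ∀ (m : ℕ) (x : Fin m → E4) (c : Fin m → ℝ), (∀ i, 0 < x i 0) →
    0 ≤ ∑ i, ∑ j, c i * c j * bigOWitness (timeReflection 4 (x i) - x j)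

def WitnessBigO : Prop := ∃ C : ℝ, ∀ x, x ≠ 0 → ‖x‖ ^ 8 * |bigOWitness x| ≤ C

def WitnessLatticeInvariant : Prop :=
  ∀ R : E4 ≃ₗᵢ[ℝ] E4,
    (∀ z : Fin 4 → ℤ, Even (∑ i, z i) → ∃ w : Fin 4 → ℤ, Even (∑ i, w i) ∧ R (siteToE z) = siteToE w) →
    ∀ x, bigOWitness (R x) = bigOWitness x

def WitnessNotRadial : Prop := ∃ (R : E4 ≃ₗᵢ[ℝ] E4) (x : E4), bigOWitness (R x) ≠ bigOWitness x

/-- The Laplace–Fourier representation that carries `WitnessReflectionPositive` (sub-target; `W ≥ 0` termwise). -/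
def WitnessLaplaceFourier : Prop :=
  ∀ (t : ℝ) (z : EuclideanSpace ℝ (Fin 3)), t ≠ 0 →
    bigOWitness ((WithLp.equiv 2 (Fin 4 → ℝ)).symm (Fin.cons t (fun j => z j)))
      = (1 / (1280 * Real.pi)) * ∫ p : EuclideanSpace ℝ (Fin 3),
          ((∑ j : Fin 3, ∑ k : Fin 3, if j ≠ k then (p j) ^ 4 * (p k) ^ 2 else 0) + 2 * ((p 0) ^ 2 * (p 1) ^ 2 * (p 2) ^ 2))
            * Real.exp (-(|t| * ‖p‖)) * Real.cos (inner ℝ p z) * ‖p‖⁻¹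

/-- Assembly of the negative target from the witness clauses (PROVED: instantiate the big-O rigidity at the witness). -/
theorem notShortRootRigidityBigO_of_witness
    (h1 : WitnessContinuousOffZero) (h2 : WitnessBoundedOutsideBall) (h3 : WitnessSignedPermInvariant)
    (h4 : WitnessReflectionPositive) (h5 : WitnessBigO) (h6 : WitnessLatticeInvariant) (h7 : WitnessNotRadial) :
    NotShortRootRigidityBigO := by
  intro hrig
  obtain ⟨R, x, hne⟩ := h7
  exact hne (hrig bigOWitness h1 h2 h3 h4 h5 h6 R x)

end Summit.QuantumFields.YangMills.Cruxes.ShortRootRigidity.Sharpness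

end
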